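/-
Copyright (c) 2026 the pub-hodgecm-mathlib formalisation cell (harness21).  Prover seat hodgecm-mathlib-F0P2-p11 (g2) (L1; LEAD F0P6-plan (g14) «(o1) KIND 1», memo
`CENSUS-K1-DealTable` brick (T4-β) core), Track B «K2-LIT» ∕ hLiu418 #184♮, ROAD Φ, G5-b: THE CORNER-LINE INTEGRAL OF THE RANK-ONE FILES IS THE RANK-ONE WHITTAKER
INTEGRAL `whittakerDelta` OF THE DOUBLED LINE, for the pulled-back section and the pushed-forward measure.  THEOREMS ONLY.
-/
import Summits.HodgeConjecture.HodgeConjecture.Theorems.K2LiuCornerLineChartTwo          -- ★ p862584 (T4-α) part 3 (+ ★ p862538, ★ `blkD`, ★ `whittakerDelta`)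
import Summits.HodgeConjecture.HodgeConjecture.Theorems.K2LiuSiegelUnipotentCharacters   -- ★ `continuous_unipDeltaChar_coe`
import HarnessLib

/-!
# Crux `HLiu418`, KIND 1, brick (T4-β) core: `∫ conj ψ_S(n₂ t) · f(w₀ · n₂ t · g) dμ(t) = whittakerDelta⁽ᴮ⁾ (nB_* μ) S₂₂ (f (blkD (1, ·) · g)) 1`

Cell `hodgecm-mathlib`, crux item hLiu418 = `stmt-HodgeConjecture-24832` (helper lane, count-neutral); squad K2 ∕ K2Liu, LEAD F0P6-plan (g14); prover F0P2-p11 (g2).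
THEOREMS ONLY (no `def`, no `instance`, no notation, no named-fact hypothesis, no `sorry`).

THE HINGE OF KIND 1 (memo `CENSUS-K1-DealTable`, (T4) «corner line = carrier A»).  ★ p861327 writes the rank-one middle-cell term as the CORNER-LINE INTEGRAL
`∫_{𝔸_{L⁺}} conj ψ_S(Λĝ⁻¹ n₂ t Λĝ) · f(w₀ · n₂ t · Λĝ h) dμ(t)` (`w₀ = ι(1, g₀)`, `n₂` the corner line), and ★ p861405 writes the singular big-cell term as the same integral of the
`N_χ(𝔸)`-period.  With Kudla's see-saw chart ★ `blkD` at `n = 2` under the corner hypothesis `he : e (1, 0) = 1`:  `w₀ = blkD (1, w_Δ⁽ᴮ⁾)` (★ p862584 §4),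
`ψ^{(V)}_S ∘ blkD (1, ·) = ψ^{(B)}_{S₂₂}` (★ p862538 §2), `f (blkD (1, ·) · g) ∈ I_Δ^{(B)}(s + ½)` (★ p862495).  THIS FILE: for ANY line chart `nB : 𝔸_{L⁺} → N_Δ⁽ᴮ⁾(𝔸)` (by value;
★ `exists_unipChart` at the line supplies it) presenting the corner line as `n₂ t = blkD (1, nB t)` (by value; ★ p862584 §1+§3 discharge it from ★ p861153's coordinate), the
corner-line integral IS ★ `whittakerDelta` of the doubled LINE `H(V₂)` at the index `S₂₂ = (σ S σ⁻¹)₂₂`, the pulled-back section `y ↦ f (blkD (1, y) · g)` and the pushed-forward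
measure `nB_* μ`, evaluated at `1`:
* §1 `blkD_one_inr_mul` — `blkD (1, y) · blkD (1, y') = blkD (1, y y')`; `integrand_eq` — the pointwise identity of the two integrands.
* §2 **`cornerLine_integral_eq_whittakerDelta_line`** — the integral identity (Mathlib `integral_map`; continuity of the Whittaker integrand for a continuous `f`).
* §3 **`cornerLine_integral_eq_whittakerDelta_line_levi`** — the same with ★ p861327's Levi-conjugated character `ψ_S(m⁻¹ · n₂ t · m)`, for ANY by-value re-indexing
  `hψ : ψ_S(m⁻¹ u m) = ψ_{S'}(u)` on `N_Δ(𝔸)` (★ `K2LiuSiegelLeviConjUnipDeltaChar.unipDeltaChar_conj_eq` supplies it with `S' = D₀ S A₀⁻¹`).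
AFTER THIS FILE the K1-b♮ pin reads: `Ebc S s h = C • whittakerDelta⁽ᴮ⁾ ν₁ S'₂₂ (f_s (blkD (1, ·) · Λĝ h)) 1` with `ν₁ = nB_* μ` a Haar measure of `N_Δ⁽ᴮ⁾(𝔸)` — a rank-ONE
Whittaker coefficient of a Siegel section of the doubled line at parameter `s + ½` (★ p862495), to which the KIND-W machinery applies at `n := 1` ((K1b-W) of the memo).
HONEST LABEL.  Count-neutral helper, hypothesis-first on the line chart; `HC_CM` is proved only modulo the 7 printed citations (2 remaining named inputs:
hLiu418 = `stmt-HodgeConjecture-24832`, h413 = `stmt-HodgeConjecture-24833`) until rung 0 closes.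

## References
* [KudlaRallis1994] S. Kudla, S. Rallis, Ann. of Math. 140 (1994), §2 (2.10)–(2.12) (singular coefficients via lower-rank Whittaker integrals).
* [Kudla1994] S. Kudla, Israel J. Math. 87 (1994), §2, Thm. 3.1.
* [MoeglinWaldspurger1995] C. Mœglin, J.-L. Waldspurger, CUP (1995), II.1.7.
* [Shimura1997] G. Shimura, CBMS 93 (1997), §18.3–18.5.
-/

set_option autoImplicit false
set_option linter.dupNamespace false -- the mandated namespace repeats `HodgeConjecture.HodgeConjecture`

noncomputable section

open scoped Matrix ComplexConjugate
open NumberField IsDedekindDomain MeasureTheory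
open Literature.NumberTheory.Automorphic Literature.NumberTheory.Automorphic.UnitaryGroup Literature.NumberTheory.GaloisRepresentations
open Literature.NumberTheory.GelbartRogawski1991 Literature.NumberTheory.GelbartRogawski1991.GRConstruction
open Literature.NumberTheory.K2Lit.SiegelDoubled
open UnitaryDualPair

namespace Summit.HodgeConjecture.HodgeConjecture.Cruxes.HLiu418.K2LiuCornerLineWhittaker

open K2LiuSiegelUnipotentFourierDefs K2LiuSiegelUnipotentCharacters K2LiuBlockDiagUnipotentChart K2LiuCornerLineChartTwo

variable (L : Type) [Field L] [NumberField L] [IsCMField L]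
variable {n₁ n₂ : ℕ} (e : Fin (1 + 1) × Fin 1 ≃ Fin 2) (eA : Fin 1 × Fin 1 ≃ Fin n₁) (eB : Fin 1 × Fin 1 ≃ Fin n₂)
  (dA : Fin 1 → L) (hdA : ∀ i, IsCMField.complexConj L (dA i) = dA i)
  (dB : Fin 1 → L) (hdB : ∀ i, IsCMField.complexConj L (dB i) = dB i)
  (dV : Fin (1 + 1) → L) (hdV : ∀ i, IsCMField.complexConj L (dV i) = dV i)
  (hVA : ∀ i, dV (Fin.castAdd 1 i) = dA i) (hVB : ∀ j, dV (Fin.natAdd 1 j) = dB j)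
  (dW : Fin 1 → L) (hdW : ∀ i, IsCMField.complexConj L (dW i) = dW i)

/-! ## §1 Pointwise: the two integrands agree -/

/-- `blkD (1, y) · blkD (1, y') = blkD (1, y·y')`. [cite: Kudla1994, §2] -/
theorem blkD_one_inr_mul (y y' : HA L eB dB hdB dW hdW) :
    blkD L e eA eB dA hdA dB hdB dV hdV hVA hVB dW hdW (1, y) * blkD L e eA eB dA hdA dB hdB dV hdV hVA hVB dW hdW (1, y') =
      blkD L e eA eB dA hdA dB hdB dV hdV hVA hVB dW hdW (1, y * y') := by
  rw [← map_mul, Prod.mk_mul_mk, mul_one]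

/-- **the integrands agree pointwise**: with `w₀ = ι(1, g₀) = blkD (1, w_Δ⁽ᴮ⁾)` (★ p862584) and `n₂ t = blkD (1, nB t)`,
`conj ψ_S(n₂ t) · f(w₀ · (n₂ t · g)) = conj ψ⁽ᴮ⁾_{S₂₂}(nB t) · f(blkD (1, w_Δ⁽ᴮ⁾ · nB t · 1) · g)` (★ p862538 for the character).
[cite: KudlaRallis1994, §2 (2.10)–(2.12)] [cite: Kudla1994, §2] -/
theorem integrand_eq (he : e (1, 0) = 1)
    {g₀ : UnitaryGroup.rationalPair (Fp L) L (IsCMField.complexConj L) (1 + 1) 1 (Matrix.diagonal dV) (Matrix.diagonal dW)}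
    (hg₀ : ((g₀ : GL (Fin (1 + 1) × Fin 1) L) : Matrix (Fin (1 + 1) × Fin 1) (Fin (1 + 1) × Fin 1) L) =
      Matrix.diagonal (fun k => 1 - 2 * (![0, 1] : Fin 2 → L) (e k)))
    (S : Matrix (Fin 2) (Fin 2) L) (f : HA L e dV hdV dW hdW → ℂ) (g : HA L e dV hdV dW hdW)
    {u : HA L e dV hdV dW hdW} {y : HA L eB dB hdB dW hdW} (hu : u = blkD L e eA eB dA hdA dB hdB dV hdV hVA hVB dW hdW (1, y)) :
    conj (unipDeltaChar L e dV hdV dW hdW S u : ℂ) *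
        f (iotaGG L e dV hdV dW hdW (1, UnitaryGroup.rationalPairToAdelic (Fp L) L (IsCMField.complexConj L) (1 + 1) 1 (Matrix.diagonal dV) (Matrix.diagonal dW) g₀) *
          (u * g)) =
      conj (unipDeltaChar L eB dB hdB dW hdW ((Matrix.reindex (idxSplit e eA eB) (idxSplit e eA eB) S).toBlocks₂₂) y : ℂ) *
        f (blkD L e eA eB dA hdA dB hdB dV hdV hVA hVB dW hdW (1, weylDelta L eB dB hdB dW hdW * y * 1) * g) := by
  rw [hu, unipDeltaChar_blkD_one_inr, iotaGG_one_eq_blkD_weylDelta L e eA eB dA hdA dB hdB dV hdV hVA hVB dW hdW he hg₀, ← mul_assoc, blkD_one_inr_mul, mul_one]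

/-! ## §2 The corner-line integral is `whittakerDelta` of the doubled line -/

/-- **THE CORNER-LINE INTEGRAL IS THE RANK-ONE WHITTAKER INTEGRAL OF THE DOUBLED LINE.**  `n = 2`, corner hypothesis `he`, the reflection `g₀` of the rank-one files (`hg₀`);
a LINE CHART `nB : 𝔸_{L⁺} → N_Δ⁽ᴮ⁾(𝔸)` (measurable, by value) presenting the corner line `n₂` (`hn₂ : n₂ t = blkD (1, nB t)`); `f` continuous, `g ∈ H(V)(𝔸)`, `μ` any measure on
`𝔸_{L⁺}`.  THEN `∫ conj ψ_S(n₂ t) · f(w₀ · (n₂ t · g)) dμ(t) = whittakerDelta⁽ᴮ⁾ (nB_* μ) S₂₂ (fun y => f (blkD (1, y) · g)) 1`, `S₂₂ = (σ S σ⁻¹)₂₂`.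
[cite: KudlaRallis1994, §2 (2.10)–(2.12)] [cite: MoeglinWaldspurger1995, II.1.7] [cite: Shimura1997, §18.3] -/
theorem cornerLine_integral_eq_whittakerDelta_line (he : e (1, 0) = 1)
    {g₀ : UnitaryGroup.rationalPair (Fp L) L (IsCMField.complexConj L) (1 + 1) 1 (Matrix.diagonal dV) (Matrix.diagonal dW)}
    (hg₀ : ((g₀ : GL (Fin (1 + 1) × Fin 1) L) : Matrix (Fin (1 + 1) × Fin 1) (Fin (1 + 1) × Fin 1) L) =
      Matrix.diagonal (fun k => 1 - 2 * (![0, 1] : Fin 2 → L) (e k)))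
    [MeasurableSpace (AdeleRing (𝓞 (Fp L)) (Fp L))] (μ : Measure (AdeleRing (𝓞 (Fp L)) (Fp L)))
    [MeasurableSpace (unipDelta L eB dB hdB dW hdW)] [BorelSpace (unipDelta L eB dB hdB dW hdW)]
    (nB : (AdeleRing (𝓞 (Fp L)) (Fp L)) → unipDelta L eB dB hdB dW hdW) (hnB : Measurable nB)
    (n₂ : (AdeleRing (𝓞 (Fp L)) (Fp L)) → HA L e dV hdV dW hdW) (hn₂ : ∀ t, n₂ t = blkD L e eA eB dA hdA dB hdB dV hdV hVA hVB dW hdW (1, ((nB t : unipDelta L eB dB hdB dW hdW) : HA L eB dB hdB dW hdW)))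
    (S : Matrix (Fin 2) (Fin 2) L) {f : HA L e dV hdV dW hdW → ℂ} (hfc : Continuous f) (g : HA L e dV hdV dW hdW) :
    ∫ t, conj (unipDeltaChar L e dV hdV dW hdW S (n₂ t) : ℂ) *
        f (iotaGG L e dV hdV dW hdW (1, UnitaryGroup.rationalPairToAdelic (Fp L) L (IsCMField.complexConj L) (1 + 1) 1 (Matrix.diagonal dV) (Matrix.diagonal dW) g₀) *
          (n₂ t * g)) ∂μ =
      whittakerDelta L eB dB hdB dW hdW (Measure.map nB μ) ((Matrix.reindex (idxSplit e eA eB) (idxSplit e eA eB) S).toBlocks₂₂)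
        (fun y => f (blkD L e eA eB dA hdA dB hdB dV hdV hVA hVB dW hdW (1, y) * g)) 1 := by
  have h3 : Continuous fun y : unipDelta L eB dB hdB dW hdW =>
      blkD L e eA eB dA hdA dB hdB dV hdV hVA hVB dW hdW (1, weylDelta L eB dB hdB dW hdW * (y : HA L eB dB hdB dW hdW) * 1) * g :=
    ((continuous_blkD L e eA eB dA hdA dB hdB dV hdV hVA hVB dW hdW).comp
      (continuous_const.prodMk ((continuous_const.mul continuous_subtype_val).mul continuous_const))).mul continuous_const
  have hcont : Continuous fun y : unipDelta L eB dB hdB dW hdW =>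
      conj (unipDeltaChar L eB dB hdB dW hdW ((Matrix.reindex (idxSplit e eA eB) (idxSplit e eA eB) S).toBlocks₂₂) (y : HA L eB dB hdB dW hdW) : ℂ) *
        f (blkD L e eA eB dA hdA dB hdB dV hdV hVA hVB dW hdW (1, weylDelta L eB dB hdB dW hdW * (y : HA L eB dB hdB dW hdW) * 1) * g) :=
    (Complex.continuous_conj.comp (continuous_unipDeltaChar_coe L eB dB hdB dW hdW _)).mul (hfc.comp h3)
  rw [whittakerDelta_def, integral_map hnB.aemeasurable hcont.aestronglyMeasurable]
  refine integral_congr_ae (Filter.Eventually.of_forall fun t => ?_)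
  exact integrand_eq L e eA eB dA hdA dB hdB dV hdV hVA hVB dW hdW he hg₀ S f g (hn₂ t)

/-! ## §3 The same with the Levi-conjugated character of ★ p861327 -/

/-- **THE CORNER-LINE INTEGRAL OF ★ p861327 AS A RANK-ONE WHITTAKER INTEGRAL**: as §2, with the character read at the Levi conjugate `m⁻¹ · n₂ t · m` and re-indexed by value
(`hψ : ψ_S(m⁻¹ u m) = ψ_{S'}(u)` on `N_Δ(𝔸)`, ★ `unipDeltaChar_conj_eq`): `∫ conj ψ_S(m⁻¹ · n₂ t · m) · f(w₀ · (n₂ t · g)) dμ(t) = whittakerDelta⁽ᴮ⁾ (nB_* μ) S'₂₂ (f (blkD (1, ·) · g)) 1`.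
[cite: KudlaRallis1994, §2 (2.10)–(2.12)] [cite: MoeglinWaldspurger1995, II.1.7] [cite: Shimura1997, §18.3] -/
theorem cornerLine_integral_eq_whittakerDelta_line_levi (he : e (1, 0) = 1)
    {g₀ : UnitaryGroup.rationalPair (Fp L) L (IsCMField.complexConj L) (1 + 1) 1 (Matrix.diagonal dV) (Matrix.diagonal dW)}
    (hg₀ : ((g₀ : GL (Fin (1 + 1) × Fin 1) L) : Matrix (Fin (1 + 1) × Fin 1) (Fin (1 + 1) × Fin 1) L) =
      Matrix.diagonal (fun k => 1 - 2 * (![0, 1] : Fin 2 → L) (e k)))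
    [MeasurableSpace (AdeleRing (𝓞 (Fp L)) (Fp L))] (μ : Measure (AdeleRing (𝓞 (Fp L)) (Fp L)))
    [MeasurableSpace (unipDelta L eB dB hdB dW hdW)] [BorelSpace (unipDelta L eB dB hdB dW hdW)]
    (nB : (AdeleRing (𝓞 (Fp L)) (Fp L)) → unipDelta L eB dB hdB dW hdW) (hnB : Measurable nB)
    (n₂ : (AdeleRing (𝓞 (Fp L)) (Fp L)) → HA L e dV hdV dW hdW) (hn₂ : ∀ t, n₂ t = blkD L e eA eB dA hdA dB hdB dV hdV hVA hVB dW hdW (1, ((nB t : unipDelta L eB dB hdB dW hdW) : HA L eB dB hdB dW hdW)))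
    (S S' : Matrix (Fin 2) (Fin 2) L) (m : HA L e dV hdV dW hdW)
    (hψ : ∀ u : HA L e dV hdV dW hdW, u ∈ unipDelta L e dV hdV dW hdW → unipDeltaChar L e dV hdV dW hdW S (m⁻¹ * u * m) = unipDeltaChar L e dV hdV dW hdW S' u)
    {f : HA L e dV hdV dW hdW → ℂ} (hfc : Continuous f) (g : HA L e dV hdV dW hdW) :
    ∫ t, conj (unipDeltaChar L e dV hdV dW hdW S (m⁻¹ * n₂ t * m) : ℂ) *
        f (iotaGG L e dV hdV dW hdW (1, UnitaryGroup.rationalPairToAdelic (Fp L) L (IsCMField.complexConj L) (1 + 1) 1 (Matrix.diagonal dV) (Matrix.diagonal dW) g₀) *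
          (n₂ t * g)) ∂μ =
      whittakerDelta L eB dB hdB dW hdW (Measure.map nB μ) ((Matrix.reindex (idxSplit e eA eB) (idxSplit e eA eB) S').toBlocks₂₂)
        (fun y => f (blkD L e eA eB dA hdA dB hdB dV hdV hVA hVB dW hdW (1, y) * g)) 1 := by
  have hmem : ∀ t, n₂ t ∈ unipDelta L e dV hdV dW hdW := fun t => by
    rw [hn₂ t]
    exact blkD_one_inr_mem_unipDelta L e eA eB dA hdA dB hdB dV hdV hVA hVB dW hdW (nB t).2
  simp_rw [hψ _ (hmem _)]
  exact cornerLine_integral_eq_whittakerDelta_line L e eA eB dA hdA dB hdB dV hdV hVA hVB dW hdW he hg₀ μ nB hnB n₂ hn₂ S' hfc g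

end Summit.HodgeConjecture.HodgeConjecture.Cruxes.HLiu418.K2LiuCornerLineWhittaker

end
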